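import Summits.ResolutionOfSingularities.ResolutionOfSingularities.Theorems.EquisingularLiftEquisingularLiftNatDeltaCentreRegular
import Literature.AlgebraicGeometry.Resolution.RegularLocalRingsQuotient
import Mathlib
import HarnessLib

/-!
# [OURS · L1 W4.5(b)] The Δ-CRITERION at ring level (1/2) — regularity of a Δ-curve `O[x_σ]/(f)` along its
# special fibre, pointwise (crux `EquisingularLiftNat` = stmt-ResolutionOfSingularities-20038, line `sections`)

NOT a statement of any manuscript. Helper file of the chain res-L1-w45b (cell `res-hironaka`, rung L, slot
W4.5(b)); AI-written, weaker than expert review; filed `--supports stmt-ResolutionOfSingularities-20038 --as helper`.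

WHERE IT SITS. res-type-100's T-CARRIER-Δ (`…NatConeChart` p508912, `…NatCarrierDeltaStalks` p509910) reads the
local rings of the Δ-centre `St_τ(K) ⊔ E` at its special points as localisations of the chart Δ-curve ring
`(R/I)[T_j : j ≠ i] ⧸ (Φ̄ᵢ)` — a ring `A ⧸ (f)` with `A = O[x_σ]` a polynomial ring over a DVR `O` (`R/I ≅ O` via the
section) and `f̄ := f mod ϖ ≠ 0` — and states the regularity clause (ii) of the step WITH THE REGULARITY OF THESE
LOCAL RINGS AS HYPOTHESIS. This file is the ring-level DISCHARGE of that hypothesis («Δ-criterion»), for an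
arbitrary finite index type `σ` (so `σ = {j : Fin 3 // j ≠ i}` is literal) and an arbitrary lift `f` (so vertical
terms `ϖ·M` of a projective lift are allowed), refining the toolkit D1 (iii) `deltaRegularGeneric` (p502482:
`σ = Fin 2`, `f = g + uϖ`).

THEOREMS (`O` a DVR with uniformizer `ϖ`, `k = O/ϖ`, `A = MvPolynomial σ O`, `f ∈ A`, `Q` a prime of `A/(f)`,
`P = Q ∩ A`, `red : A → k[x_σ]` the reduction):
* (Δ1) `isRegularLocalRing_localization_quotient_iff_notMem_sq` — for ANY regular domain `A` and `f ≠ 0`: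
  `(A/(f))_Q` is regular iff `f ∉ 𝔪_P²` in `A_P` (Matsumura 14.2 and its converse for one element).
* (Δ2) `isRegularLocalRing_localization_deltaCurve_of_notMem_sq_reduction` — if the reduced TRACE `D = V(f̄)` is
  regular at the point `𝔮` of `k[x_σ]` below `Q` (`f̄ ∉ 𝔪_𝔮²`), then `(A/(f))_Q` is regular, WHATEVER THE LIFT `f` of
  `f̄` (no condition on its `ϖ`-part); `…_of_forall_notMem_sq_reduction` (all points: `D` regular everywhere ⇒ `A/(f)`
  regular at every prime containing `ϖ`) and `…_of_isRegularRing_reduction` (the same from `IsRegularRing (k[x_σ]/(f̄))`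
  — the case of a smooth trace, e.g. H_F's `Z = V(F₇)` or a line); the generic lifting lemma
  `isRegularLocalRing_localization_of_quotient_nonZeroDivisor` (any Noetherian `B`, `t ∈ Q` a non-zero-divisor:
  `B_Q/(t)` regular ⇒ `B_Q` regular, Matsumura 19.2 (II)) with `mk_C_mem_nonZeroDivisors` (`ϖ` is a non-zero-divisor
  on `A/(f)` when `f̄ ≠ 0`) for consumers who hold the special fibre as a quotient of the stalk instead.
* (Δ3)/(Δ4) — at most one bad residue per singular point of the trace for the lifts `g + c·ϖ·h`, and generic
  regularity of such lifts — are the sequel `…Theorems.EquisingularLiftEquisingularLiftNatDeltaCriterionGeneric`.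

References: H. Matsumura, *Commutative Ring Theory* (1986), Thms. 14.2, 19.2. res-L1-w45b-lead-2 TARGETS (2)
«(ii) V(C) regular iff the Δ-criterion at every special point» and res-type-100 SIGNATURE T-CARRIER-Δ (OURS planning
texts, index only).
-/

set_option linter.dupNamespace false -- mandated namespace `Summit.<Summit>.<Problem>` of this single-conjunct summit
set_option linter.overlappingInstances false -- signatures carry both [IsDomain O] and [IsDiscreteValuationRing O] (Mathlib's class takes the former as a parameter)

namespace Summit.ResolutionOfSingularities.ResolutionOfSingularities.Cruxes.EquisingularLiftNat.Sections

open MvPolynomial IsLocalRing Literature.AlgebraicGeometry.Resolution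
open Summit.ResolutionOfSingularities.ResolutionOfSingularities.Theorems

universe u

/-! ## (Δ1) The order-one criterion as an equivalence, for a hypersurface of a regular domain -/

section OrderOne

variable {A : Type u} [CommRing A] [IsDomain A] [IsRegularRing A]

/-- **(Δ1) Order-one criterion, both ways.** Let `A` be a regular domain, `0 ≠ f ∈ A`, `Q` a prime of `A/(f)`
and `P = Q ∩ A`. Then `(A/(f))_Q ≅ A_P/(f)` is a regular local ring iff `f ∉ 𝔪_P²` (Matsumura 14.2, tree
`isRegularLocalRing_localization_quotient_of_notMem_sq`; conversely a regular local ring modulo a non-zero-divisor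
of `𝔪²` is never regular, `not_mem_sq_of_isRegularLocalRing_quotient`, p501885). [cite: Matsumura1987, Thm. 14.2]
[OURS · L1 W4.5b] -/
theorem isRegularLocalRing_localization_quotient_iff_notMem_sq {f : A} (hf : f ≠ 0)
    (Q : Ideal (A ⧸ Ideal.span {f})) [Q.IsPrime] :
    IsRegularLocalRing (Localization.AtPrime Q) ↔
      algebraMap A (Localization.AtPrime (Q.comap (Ideal.Quotient.mk (Ideal.span {f})))) f ∉
        maximalIdeal (Localization.AtPrime (Q.comap (Ideal.Quotient.mk (Ideal.span {f})))) ^ 2 := by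
  set P := Q.comap (Ideal.Quotient.mk (Ideal.span {f})) with hP
  haveI : IsRegularLocalRing (Localization.AtPrime P) := IsRegularRing.isRegularLocalRing_localization P
  refine ⟨fun hreg => ?_, fun hf2 => isRegularLocalRing_localization_quotient_of_notMem_sq Q hf2⟩
  have hfP : f ∈ P := by
    rw [hP, Ideal.mem_comap, Ideal.Quotient.eq_zero_iff_mem.mpr (Ideal.mem_span_singleton_self f)]
    exact Q.zero_mem
  have h2 := (isRegularLocalRing_localization_quotient_iff (Ideal.span {f}) P Q rfl).mp hreg
  have hJ' : (Ideal.span {f}).map (algebraMap A (Localization.AtPrime P)) =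
      Ideal.span {algebraMap A (Localization.AtPrime P) f} := by
    rw [Ideal.map_span, Set.image_singleton]
  rw [hJ'] at h2
  have hmem : algebraMap A (Localization.AtPrime P) f ∈ maximalIdeal (Localization.AtPrime P) := by
    rw [← Localization.AtPrime.map_eq_maximalIdeal]
    exact Ideal.mem_map_of_mem _ hfP
  have hinj : Function.Injective (algebraMap A (Localization.AtPrime P)) :=
    IsLocalization.injective (Localization.AtPrime P) P.primeCompl_le_nonZeroDivisors
  have hne : algebraMap A (Localization.AtPrime P) f ≠ 0 := by
    rw [Ne, ← map_zero (algebraMap A (Localization.AtPrime P)), hinj.eq_iff]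
    exact hf
  have hreg' : IsSMulRegular (Localization.AtPrime P) (algebraMap A (Localization.AtPrime P) f) :=
    (IsRegular.of_ne_zero hne).left.isSMulRegular
  exact not_mem_sq_of_isRegularLocalRing_quotient hmem hreg' h2

end OrderOne

/-! ## (Δ2, general) Regularity lifts from a Cartier divisor through the point -/

section LiftFromDivisor

variable {B : Type u} [CommRing B] [IsNoetherianRing B]

/-- **Regularity lifts from a Cartier divisor through the point.** Let `B` be Noetherian, `t ∈ B` a
non-zero-divisor and `Q ∋ t` a prime. If `B_Q/(t)` is a regular local ring then so is `B_Q` (`t/1 ∈ 𝔪_Q` stays a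
non-zero-divisor in the localisation; Matsumura 19.2 (II), tree `IsRegularLocalRing.of_quotient_span_singleton`).
[cite: Matsumura1987, Thm. 19.2] [OURS · L1 W4.5b] -/
theorem isRegularLocalRing_localization_of_quotient_nonZeroDivisor {t : B} (ht : t ∈ nonZeroDivisors B)
    (Q : Ideal B) [Q.IsPrime] (hQ : t ∈ Q)
    (hreg : IsRegularLocalRing (Localization.AtPrime Q ⧸ Ideal.span {algebraMap B (Localization.AtPrime Q) t})) :
    IsRegularLocalRing (Localization.AtPrime Q) := by
  set L := Localization.AtPrime Q with hL
  have hmem : algebraMap B L t ∈ maximalIdeal L := by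
    rw [← Localization.AtPrime.map_eq_maximalIdeal]
    exact Ideal.mem_map_of_mem _ hQ
  have htL : algebraMap B L t ∈ nonZeroDivisors L := IsLocalization.nonZeroDivisors_le_comap Q.primeCompl L ht
  have hregL : IsSMulRegular L (algebraMap B L t) :=
    (isRegular_iff_mem_nonZeroDivisors.mpr htL).left.isSMulRegular
  haveI := hreg
  exact IsRegularLocalRing.of_quotient_span_singleton hmem hregL

end LiftFromDivisor

/-! ## The ambient polynomial ring `A = O[x_σ]` over a DVR: reduction mod `ϖ`, `A_P/(ϖ)` regular, `ϖ ∉ 𝔪_P²` -/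

section Ambient

variable {O : Type u} [CommRing O] [IsDomain O] [IsDiscreteValuationRing O] {ϖ : O}
variable {σ : Type u} [Finite σ]

omit [IsDomain O] [IsDiscreteValuationRing O] [Finite σ] in
/-- The reduction map `O[x_σ] → (O/ϖ)[x_σ]` kills exactly `(ϖ)`. [folklore] -/
theorem ker_map_mk_span_singleton (ϖ : O) :
    RingHom.ker (MvPolynomial.map (σ := σ) (Ideal.Quotient.mk (Ideal.span {ϖ}))) =
      Ideal.span {(C ϖ : MvPolynomial σ O)} := by
  rw [MvPolynomial.ker_map, Ideal.mk_ker, Ideal.map_span, Set.image_singleton]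

omit [IsDomain O] [IsDiscreteValuationRing O] [Finite σ] in
/-- The reduction of `C (c * ϖ)` is zero. [folklore] -/
theorem map_mk_C_mul (c ϖ : O) :
    MvPolynomial.map (σ := σ) (Ideal.Quotient.mk (Ideal.span {ϖ})) (C (c * ϖ)) = 0 := by
  rw [map_C, Ideal.Quotient.eq_zero_iff_mem.mpr (Ideal.mul_mem_left _ c (Ideal.mem_span_singleton_self ϖ)), C_0]

omit [IsDomain O] [IsDiscreteValuationRing O] [Finite σ] in
/-- The reduction of a lift with a vertical term: `(g + c·ϖ·h)‾ = ḡ`. [folklore] -/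
theorem map_mk_add_C_mul_mul (c ϖ : O) (g h : MvPolynomial σ O) :
    MvPolynomial.map (σ := σ) (Ideal.Quotient.mk (Ideal.span {ϖ})) (g + C (c * ϖ) * h) =
      MvPolynomial.map (Ideal.Quotient.mk (Ideal.span {ϖ})) g := by
  rw [map_add, map_mul, map_mk_C_mul, zero_mul, add_zero]

/-- For a prime `P ∋ ϖ` of `A = O[x_σ]` (`O` a DVR with uniformizer `ϖ`, `σ` finite): `A_P/(ϖ) ≅ (k[x_σ])_𝔮` is a
regular local ring (`k = O/ϖ`; localisation commutes with quotients; `k[x_σ]` is regular, Mathlib). General-`σ`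
form of `isRegularLocalRing_localization_quotient_C` (p502482). [folklore] [OURS · L1 W4.5b] -/
theorem isRegularLocalRing_localization_quotient_C' (hϖ : Irreducible ϖ)
    (P : Ideal (MvPolynomial σ O)) [P.IsPrime] (hP : (C ϖ : MvPolynomial σ O) ∈ P) :
    IsRegularLocalRing (Localization.AtPrime P ⧸
      Ideal.span {algebraMap (MvPolynomial σ O) (Localization.AtPrime P) (C ϖ)}) := by
  set A := MvPolynomial σ O with hA
  set J : Ideal A := (Ideal.span {ϖ}).map (C : O →+* A) with hJdef
  have hJ : J = Ideal.span {(C ϖ : A)} := by rw [hJdef, Ideal.map_span, Set.image_singleton]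
  have hJP : J ≤ P := by rw [hJ, Ideal.span_singleton_le_iff_mem]; exact hP
  obtain ⟨hprime, hcomap⟩ := isPrime_map_mk_and_comap_eq J P hJP
  haveI := hprime
  haveI hmax : (Ideal.span {ϖ}).IsMaximal := PrincipalIdealRing.isMaximal_of_irreducible hϖ
  letI : Field (O ⧸ Ideal.span {ϖ}) := Ideal.Quotient.field _
  haveI : IsRegularRing (A ⧸ J) :=
    IsRegularRing.of_ringEquiv
      (MvPolynomial.quotientEquivQuotientMvPolynomial (σ := σ) (Ideal.span {ϖ})).toRingEquiv
  have h1 : IsRegularLocalRing (Localization.AtPrime (P.map (Ideal.Quotient.mk J))) :=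
    IsRegularRing.isRegularLocalRing_localization _
  have h2 := (isRegularLocalRing_localization_quotient_iff J P (P.map (Ideal.Quotient.mk J)) hcomap).mp h1
  have hJ' : J.map (algebraMap A (Localization.AtPrime P)) =
      Ideal.span {algebraMap A (Localization.AtPrime P) (C ϖ)} := by
    rw [hJ, Ideal.map_span, Set.image_singleton]
  rw [hJ'] at h2
  exact h2

/-- For a prime `P ∋ ϖ` of `A = O[x_σ]`: `ϖ ∉ 𝔪_P²` in the regular local ring `A_P` (its quotient by `ϖ` is
regular). General-`σ` form of `C_varpi_notMem_sq` (p502482). [folklore] [OURS · L1 W4.5b] -/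
theorem C_varpi_notMem_sq' (hϖ : Irreducible ϖ)
    (P : Ideal (MvPolynomial σ O)) [P.IsPrime] (hP : (C ϖ : MvPolynomial σ O) ∈ P) :
    algebraMap (MvPolynomial σ O) (Localization.AtPrime P) (C ϖ) ∉
      maximalIdeal (Localization.AtPrime P) ^ 2 := by
  set A := MvPolynomial σ O with hA
  set L := Localization.AtPrime P with hL
  haveI : IsRegularLocalRing L := IsRegularRing.isRegularLocalRing_localization P
  have hmem : algebraMap A L (C ϖ) ∈ maximalIdeal L := by
    rw [← Localization.AtPrime.map_eq_maximalIdeal]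
    exact Ideal.mem_map_of_mem _ hP
  have hinj : Function.Injective (algebraMap A L) :=
    IsLocalization.injective L P.primeCompl_le_nonZeroDivisors
  have hne : algebraMap A L (C ϖ) ≠ 0 := by
    rw [Ne, ← map_zero (algebraMap A L), hinj.eq_iff, MvPolynomial.C_eq_zero]
    exact hϖ.ne_zero
  have hreg : IsSMulRegular L (algebraMap A L (C ϖ)) :=
    (IsRegular.of_ne_zero hne).left.isSMulRegular
  exact not_mem_sq_of_isRegularLocalRing_quotient hmem hreg
    (isRegularLocalRing_localization_quotient_C' hϖ P hP)

omit [Finite σ] in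
/-- `ϖ` is a non-zero-divisor on the Δ-curve ring `O[x_σ]/(f)` as soon as `f̄ ≠ 0` (then `ϖ ∤ f`, and `ϖ` is
prime in `O[x_σ]`; tree `mem_span_singleton_of_C_mul_mem_of_map_ne_zero`, p503994). [folklore] [OURS · L1 W4.5b] -/
theorem mk_C_mem_nonZeroDivisors (hϖ : Irreducible ϖ) {f : MvPolynomial σ O}
    (hf : MvPolynomial.map (Ideal.Quotient.mk (Ideal.span {ϖ})) f ≠ 0) :
    Ideal.Quotient.mk (Ideal.span {f}) (C ϖ : MvPolynomial σ O) ∈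
      nonZeroDivisors (MvPolynomial σ O ⧸ Ideal.span {f}) := by
  have hprime : (Ideal.span {ϖ}).IsPrime := (Ideal.span_singleton_prime hϖ.ne_zero).mpr hϖ.prime
  rw [mem_nonZeroDivisors_iff_right]
  intro m hm
  obtain ⟨h, rfl⟩ := Ideal.Quotient.mk_surjective m
  rw [← map_mul, Ideal.Quotient.eq_zero_iff_mem, mul_comm] at hm
  exact Ideal.Quotient.eq_zero_iff_mem.mpr (mem_span_singleton_of_C_mul_mem_of_map_ne_zero hprime hϖ.ne_zero hf hm)

end Ambient

/-! ## (Δ2) Regularity of the trace at the point forces regularity of the Δ-curve there, for every lift -/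

section SpecialFibre

variable {O : Type u} [CommRing O] [IsDomain O] [IsDiscreteValuationRing O] {ϖ : O}
variable {σ : Type u} [Finite σ]

/-- **(Δ2) The Δ-criterion, first half: `D` regular at the point ⇒ Δ regular at the point, for EVERY lift.**
`O` a DVR with uniformizer `ϖ`, `k = O/ϖ`, `σ` finite, `A = O[x_σ]`, `f ∈ A`, `Q` a prime of the Δ-curve ring
`A/(f)`, `P = Q ∩ A`, and `𝔮` the prime of `k[x_σ]` below it (`red⁻¹ 𝔮 = P`; it exists iff `ϖ ∈ Q`). If
`f̄ ∉ 𝔪_𝔮²` in `k[x_σ]_𝔮` — i.e. the reduced trace `D = V(f̄)` is REGULAR at the point `𝔮` (order-one criterion in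
the regular ring `k[x_σ]`) — then `(A/(f))_Q` is a regular local ring: the local homomorphism `A_P → k[x_σ]_𝔮` maps
`𝔪_P²` into `𝔪_𝔮²` and `f ↦ f̄`, so `f ∉ 𝔪_P²` (`notMem_sq_of_map_notMem_sq`, p501885), and Matsumura 14.2 applies
in the regular local ring `A_P`. NO condition on the `ϖ`-part of the lift `f` of `f̄`. [cite: Matsumura1987, Thm. 14.2]
[OURS · L1 W4.5b] -/
theorem isRegularLocalRing_localization_deltaCurve_of_notMem_sq_reduction {f : MvPolynomial σ O}
    (Q : Ideal (MvPolynomial σ O ⧸ Ideal.span {f})) [Q.IsPrime]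
    (𝔮 : PrimeSpectrum (MvPolynomial σ (O ⧸ Ideal.span {ϖ})))
    (h𝔮 : 𝔮.asIdeal.comap (MvPolynomial.map (Ideal.Quotient.mk (Ideal.span {ϖ}))) =
      Q.comap (Ideal.Quotient.mk (Ideal.span {f})))
    (h1 : algebraMap (MvPolynomial σ (O ⧸ Ideal.span {ϖ})) (Localization.AtPrime 𝔮.asIdeal)
      (MvPolynomial.map (Ideal.Quotient.mk (Ideal.span {ϖ})) f) ∉
        maximalIdeal (Localization.AtPrime 𝔮.asIdeal) ^ 2) :
    IsRegularLocalRing (Localization.AtPrime Q) := by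
  haveI : IsRegularLocalRing (Localization.AtPrime (Q.comap (Ideal.Quotient.mk (Ideal.span {f})))) :=
    IsRegularRing.isRegularLocalRing_localization _
  exact isRegularLocalRing_localization_quotient_of_notMem_sq Q
    (notMem_sq_of_map_notMem_sq (MvPolynomial.map (σ := σ) (Ideal.Quotient.mk (Ideal.span {ϖ}))) 𝔮.asIdeal
      (Q.comap (Ideal.Quotient.mk (Ideal.span {f}))) h𝔮.symm h1)

/-- **(Δ2, along the whole special fibre).** `O` a DVR with uniformizer `ϖ`, `k = O/ϖ`, `σ` finite, `f ∈ O[x_σ]`. If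
the reduced trace `D = V(f̄) ⊂ 𝔸^σ_k` is regular at EVERY point — `f̄ ∉ 𝔪_𝔮²` for every prime `𝔮 ∋ f̄` of `k[x_σ]`
(e.g. a smooth plane curve) — then the Δ-curve ring `O[x_σ]/(f)` is a regular local ring at every prime containing
`ϖ`, whatever the lift `f` of `f̄`. [cite: Matsumura1987, Thm. 14.2] [OURS · L1 W4.5b] -/
theorem isRegularLocalRing_localization_deltaCurve_of_forall_notMem_sq_reduction {f : MvPolynomial σ O}
    (h1 : ∀ 𝔮 : PrimeSpectrum (MvPolynomial σ (O ⧸ Ideal.span {ϖ})),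
      MvPolynomial.map (Ideal.Quotient.mk (Ideal.span {ϖ})) f ∈ 𝔮.asIdeal →
      algebraMap (MvPolynomial σ (O ⧸ Ideal.span {ϖ})) (Localization.AtPrime 𝔮.asIdeal)
        (MvPolynomial.map (Ideal.Quotient.mk (Ideal.span {ϖ})) f) ∉
          maximalIdeal (Localization.AtPrime 𝔮.asIdeal) ^ 2)
    (Q : Ideal (MvPolynomial σ O ⧸ Ideal.span {f})) [Q.IsPrime]
    (hQ : Ideal.Quotient.mk (Ideal.span {f}) (C ϖ : MvPolynomial σ O) ∈ Q) :
    IsRegularLocalRing (Localization.AtPrime Q) := by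
  have hker : RingHom.ker (MvPolynomial.map (σ := σ) (Ideal.Quotient.mk (Ideal.span {ϖ}))) =
      Ideal.span {(C ϖ : MvPolynomial σ O)} := ker_map_mk_span_singleton ϖ
  have hsurj : Function.Surjective (MvPolynomial.map (σ := σ) (Ideal.Quotient.mk (Ideal.span {ϖ}))) :=
    MvPolynomial.map_surjective _ Ideal.Quotient.mk_surjective
  -- the prime `P = Q ∩ A ⊇ (f, ϖ)` of `A` and its image `𝔮 ∋ f̄` in `k[x_σ]`
  have hfP : f ∈ Q.comap (Ideal.Quotient.mk (Ideal.span {f})) := by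
    rw [Ideal.mem_comap, Ideal.Quotient.eq_zero_iff_mem.mpr (Ideal.mem_span_singleton_self _)]
    exact Q.zero_mem
  have hϖP : (C ϖ : MvPolynomial σ O) ∈ Q.comap (Ideal.Quotient.mk (Ideal.span {f})) := by
    rw [Ideal.mem_comap]; exact hQ
  have hkerP : RingHom.ker (MvPolynomial.map (σ := σ) (Ideal.Quotient.mk (Ideal.span {ϖ}))) ≤
      Q.comap (Ideal.Quotient.mk (Ideal.span {f})) := by
    rw [hker, Ideal.span_singleton_le_iff_mem]; exact hϖP
  haveI h𝔮prime : ((Q.comap (Ideal.Quotient.mk (Ideal.span {f}))).map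
      (MvPolynomial.map (σ := σ) (Ideal.Quotient.mk (Ideal.span {ϖ})))).IsPrime :=
    Ideal.map_isPrime_of_surjective hsurj hkerP
  let 𝔮 : PrimeSpectrum (MvPolynomial σ (O ⧸ Ideal.span {ϖ})) :=
    ⟨(Q.comap (Ideal.Quotient.mk (Ideal.span {f}))).map (MvPolynomial.map (Ideal.Quotient.mk (Ideal.span {ϖ}))),
      h𝔮prime⟩
  have hcomapq : 𝔮.asIdeal.comap (MvPolynomial.map (σ := σ) (Ideal.Quotient.mk (Ideal.span {ϖ}))) =
      Q.comap (Ideal.Quotient.mk (Ideal.span {f})) := by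
    change ((Q.comap (Ideal.Quotient.mk (Ideal.span {f}))).map _).comap _ = _
    rw [Ideal.comap_map_of_surjective _ hsurj, ← RingHom.ker_eq_comap_bot, sup_eq_left.mpr hkerP]
  have hfq : MvPolynomial.map (Ideal.Quotient.mk (Ideal.span {ϖ})) f ∈ 𝔮.asIdeal := Ideal.mem_map_of_mem _ hfP
  exact isRegularLocalRing_localization_deltaCurve_of_notMem_sq_reduction Q 𝔮 hcomapq (h1 𝔮 hfq)

/-- In a regular domain `B` with `0 ≠ f`: if `B/(f)` is a regular ring then `f ∉ 𝔪_𝔮²` at every prime `𝔮 ∋ f`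
(`(B/(f))_{𝔮/(f)}` is regular; converse order-one criterion). [cite: Matsumura1987, Thm. 14.2] [OURS · L1 W4.5b] -/
theorem notMem_sq_of_isRegularRing_quotient {B : Type u} [CommRing B] [IsDomain B] [IsRegularRing B] {f : B}
    (hf : f ≠ 0) [IsRegularRing (B ⧸ Ideal.span {f})] (𝔮 : PrimeSpectrum B) (hf𝔮 : f ∈ 𝔮.asIdeal) :
    algebraMap B (Localization.AtPrime 𝔮.asIdeal) f ∉ maximalIdeal (Localization.AtPrime 𝔮.asIdeal) ^ 2 := by
  have hJq : Ideal.span {f} ≤ 𝔮.asIdeal := by rw [Ideal.span_singleton_le_iff_mem]; exact hf𝔮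
  obtain ⟨hprime, hcomap⟩ := isPrime_map_mk_and_comap_eq (Ideal.span {f}) 𝔮.asIdeal hJq
  haveI := hprime
  have hreg : IsRegularLocalRing (Localization.AtPrime (𝔮.asIdeal.map (Ideal.Quotient.mk (Ideal.span {f})))) :=
    IsRegularRing.isRegularLocalRing_localization _
  have h := (isRegularLocalRing_localization_quotient_iff_notMem_sq hf
    (𝔮.asIdeal.map (Ideal.Quotient.mk (Ideal.span {f})))).mp hreg
  exact (mem_sq_maximalIdeal_localization_iff_of_eq hcomap _).not.mp h

/-- **(Δ2, global form) A Δ-curve with REGULAR TRACE is regular along its special fibre, whatever the lift.**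
For `O` a DVR with uniformizer `ϖ`, `k = O/ϖ`, `σ` finite and `f ∈ O[x_σ]` with `f̄ ≠ 0` and `k[x_σ]/(f̄)` a
REGULAR RING (the trace `D = V(f̄)` is regular, e.g. a smooth affine plane curve), the Δ-curve ring `O[x_σ]/(f)` is
a regular local ring at every prime containing `ϖ`. [cite: Matsumura1987, Thms. 14.2] [OURS · L1 W4.5b] -/
theorem isRegularLocalRing_localization_deltaCurve_of_isRegularRing_reduction {f : MvPolynomial σ O}
    (hf : MvPolynomial.map (Ideal.Quotient.mk (Ideal.span {ϖ})) f ≠ 0)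
    (hreg : IsRegularRing (MvPolynomial σ (O ⧸ Ideal.span {ϖ}) ⧸
      Ideal.span {MvPolynomial.map (Ideal.Quotient.mk (Ideal.span {ϖ})) f}))
    (hϖ : Irreducible ϖ)
    (Q : Ideal (MvPolynomial σ O ⧸ Ideal.span {f})) [Q.IsPrime]
    (hQ : Ideal.Quotient.mk (Ideal.span {f}) (C ϖ : MvPolynomial σ O) ∈ Q) :
    IsRegularLocalRing (Localization.AtPrime Q) := by
  haveI hmax : (Ideal.span {ϖ}).IsMaximal := PrincipalIdealRing.isMaximal_of_irreducible hϖ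
  letI : Field (O ⧸ Ideal.span {ϖ}) := Ideal.Quotient.field _
  haveI := hreg
  exact isRegularLocalRing_localization_deltaCurve_of_forall_notMem_sq_reduction
    (fun 𝔮 hf𝔮 => notMem_sq_of_isRegularRing_quotient hf 𝔮 hf𝔮) Q hQ

end SpecialFibre

end Summit.ResolutionOfSingularities.ResolutionOfSingularities.Cruxes.EquisingularLiftNat.Sections
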